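import Summits.QuantumFields.BalabanUV.Beta.FP.TowerCompanionInstance
import Summits.QuantumFields.BalabanUV.Beta.FP.NestedStepLawTorusCompositeOneShotTopSym

/-!
# `BalabanUV.Beta.FP.TowerHSideRowsClosing` — road «FP» for binder row D1, ROUTE T (β1) ∕ R-FP-74–75 ∕ SPEC-46 §C ∕ SPEC-47 §B: **leaf-05's tower closing
# (`TowerCompanionInstance` §4∕§5) REPACKAGED AS THE DOOR's THREE H-SIDE ROWS `hH₁l ∕ hH₁t ∕ a1` of the bounded named tower law, directions ABSTRACT-LINEAR,
# the finest form at LEVEL 0 in the law's own spelling, `Y₁f := 0`; (K1) and the links DISPLAYED**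

WHAT.  `TowerKernelLawNamedB.hessKer_law_tower_named` displays, per box, a first-order Hessian jet `H₁f : V → Matrix (fields of the finest torus)` with three
rows: linearity `hH₁l`, antisymmetry `hH₁t`, and the first-order Ward row `a1 : H₁f v * W₀ + H₀ * W₁f v = 𝔔₀ᵀ * Y₁f v` (`W₀ = towerGen`, `W₁f v` the linearised
Wilson-line column along the top direction, `H₀` the finest form's field block).  leaf-05 closes exactly this row AT THE TOTAL SLOT
`H₁ := (−2cW) • Σ_b hb n b • W_b|ff + w n • Σ_ā hb n ā • Λ_ā|ff + compSumSym Lc (onTowerFamily Lc M (k ↦ w k • Σ_ā hb k ā • Λ_ā|ff)) M lev ρ_c n` (Wilson family, the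
finest Λ table, the storeys' NAMED companion sum) for ONE family of storey directions `hb k`, under the displayed finest KKT row (K1) and the `n` links
(`tower_a1_row_towerGen_eq_zero_onTowerFamily`, `2 ≤ Lc`), with `hH₁t` by `tower_H1_total_transpose` + `onTowerFamily_lam_transpose`.  THIS FILE is the
[folklore] bridge to the door's format, at the END's level (the law's `lev (n+1) = 0`, SPEC-46 §C — only there do the two finest forms meet):
* §1 `H1f_linear` — for storey directions `hb k : V → …` LINEAR in an abstract direction `v` (the row's transported directions), the prescribed `v ↦ H₁f v` is
  linear (`hH₁l`): finite sums + leaf-06's `onTowerFamily_add ∕ _smul` + `compSumG_add ∕ _smul`;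
* §2 `H1f_transpose` — `(H₁f v)ᵀ = −H₁f v` (`hH₁t`) for every `v`, by name;
* §3 `a1_row_eq_zero ∕ a1_row` — `H₁f v * W₀ + H₀ * W₁f v = 0` (`= 𝔔₀ᵀ * 0`, the door's `a1` at `Y₁f := 0`, R-FP-75 (ii)) for every `v`, from (K1) `∀ v` and the links
  `∀ v`, with `H₀` in the LAW's spelling `(perF … (bhKStepSh d Lc (Dsh Lc) j))|ff` at `j = 0` (its field block is the rooted step kernel's,
  `NestedStepLawTorusCompositeOneShotTopSym.bhKStepSh_Dsh_inl_inl_eq_bhKStepAt`, any root; here `ρ` free, `L := Lc`), `W₀ ∕ W₁f` in the law's pins.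
[folklore] packaging BY NAME of OUR typed declarations; no `def`, no `def … : Prop`, nothing cited, 0 sorry.  (K1), the links, `cf w κ hb` and their laws
are HYPOTHESES here exactly as in leaf-05's closing — whether THE LITERAL inhabits (K1) is the row's registered Q-an2-g59-2 (an2 g59 W-4 (4), journal l.66570:
«by value first»); this bridge neither asserts nor needs it, and is the piece SPEC-47 §B's wrapper v3 would call once that answer is in.  Nothing of the
dictionary ∕ Bałaban's asserted, valued or discharged.  No existing file touched.

HONEST DEPENDENCY (page 1, mandatory): continuum YM on T⁴ ⇐ BetaPertH ∧ nine spine estimates (0/9 proved); BetaPertH ⇐ (D1) ∧ (D4) ∧ CAP+tail;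
G-an2-4 gates asym, D1 and NE2/3/4.  HONEST FRAMING (cell contract, verbatim): «discharging `BetaPertH` makes Bałaban's UV stability UNCONDITIONAL —
a real constructive-QFT result; it is NOT the continuum limit and NOT the Clay problem.»  ABSOLUTE RULE (cell charter, verbatim): «No internally-minted
statement may enter as a cited fact. Every hypothesis is either kernel-proved in this package or a verbatim quotation of a PUBLISHED theorem with page
reference. The manuscript(s) under audit are NOT citable for their own disputed steps — they are the thing under adjudication; programme-internal
(2001/route/tribunal) claims are never citable.»  0 estimates; 0∕4 row-D1 binders (hW, hR, D1Tel, D1Rep); NOT (C1), NOT (T-ID), NOT SDF, NOT D1,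
NOT BetaPertH, NOT continuum, NOT Clay.  Road «FP» OWNER, b2b-balaban-beta-d1-p3 gen 35, 2026-08-25.
-/

noncomputable section

namespace Summit.QuantumFields.BalabanUV.Beta.FP.TowerHSideRowsClosing

open scoped BigOperators Matrix
open Finset Matrix
open Literature.MathematicalPhysics.QuantumFieldTheory.Balaban1983to89
open Literature.MathematicalPhysics.QuantumFieldTheory.Balaban1983to89.Beta
open B4TorusKernel.MultiPeriod (translate)
open B5Prop11Plancherel (fine)
open B6Lemma24Torus (pbox)
open AffineAveraging (Site box toSite unitVec)
open AveragingContoursRooted (ctr ctrOff)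
open OneStepResolventKernel (Fib)
open InterLevelTransport (SLam)
open StepJetData (wilsonA)
open Summit.QuantumFields.BalabanUV.Beta.SymAveragingHessianCounts (symHessFFAt symLinKerAt)
open Summit.QuantumFields.BalabanUV.Beta.BorderedHessian (bhKStepAt stepScale)
open Summit.QuantumFields.BalabanUV.Beta.SymShiftedSpread (bhKStepSh)
open Summit.QuantumFields.BalabanUV.Beta.DshAn1 (Dsh)
open Summit.QuantumFields.BalabanUV.Beta.FP.KernelPeriodisationFib (Idx perF perF_apply perZ_apply)
open Summit.QuantumFields.BalabanUV.Beta.FP.KernelPeriodisationFibLoc (dper)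
open Summit.QuantumFields.BalabanUV.Beta.FP.TorusCompositeObjects (towerTorus NParam towerGen)
open Summit.QuantumFields.BalabanUV.Beta.FP.TorusCompositeObjectsG (QSym)
open Summit.QuantumFields.BalabanUV.Beta.FP.TorusCompositeFP (evalN)
open Summit.QuantumFields.BalabanUV.Beta.FP.TorusCompositeCompanionSumG (compSumG compSumSym compSumG_add compSumG_smul)
open Summit.QuantumFields.BalabanUV.Beta.FP.TorusCompositeCompanionFamilyG (onTowerFamily onTowerFamily_add onTowerFamily_smul)
open Summit.QuantumFields.BalabanUV.Beta.FP.TowerCompanionInstance (tower_a1_row_towerGen_eq_zero_onTowerFamily tower_H1_total_transpose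
  onTowerFamily_lam_transpose)
open Summit.QuantumFields.BalabanUV.Beta.FP.NestedStepLawTorusCompositeOneShotTopSym (bhKStepSh_Dsh_inl_inl_eq_bhKStepAt)

variable {d : ℕ} (Lc : ℕ) (N : ℕ)

/-! ## §0 Linearity of a weighted matrix family in its weights -/

/-- [folklore] `h ↦ c • Σ_a h a • Φ a` is linear in the weight vector `h`. -/
theorem smul_sum_smul_linear {α : Type*} [Fintype α] {m : Type*} (c r : ℝ) (Φ : α → Matrix m m ℝ) (h₁ h₂ : α → ℝ) :
    c • ∑ a, (r • h₁ + h₂) a • Φ a = r • (c • ∑ a, h₁ a • Φ a) + c • ∑ a, h₂ a • Φ a := by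
  simp only [Pi.add_apply, Pi.smul_apply, smul_eq_mul, add_smul, mul_smul, Finset.sum_add_distrib, ← Finset.smul_sum, smul_add]
  rw [smul_comm c r]

/-! ## §1 `hH₁l`: the prescribed total-slot `H₁f` is LINEAR in the direction -/

/-- [folklore] **`H1f_linear` — the door's `hH₁l` at the total slot.**  For storey directions `hb k : V → …` linear in an abstract direction `v`, the prescribed
`H₁f v = (−2cW) • Σ_b hb n v b • W_b|ff + w n • Σ_ā hb n v ā • Λ_ā|ff + compSumSym Lc (onTowerFamily Lc M (k ↦ w k • Σ_ā hb k v ā • Λ_ā|ff)) M lev ρ_c n` is linear in `v`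
(finite sums; leaf-06's `onTowerFamily_add ∕ _smul`, `compSumG_add ∕ _smul`). -/
theorem H1f_linear [NeZero Lc] [NeZero N] (n : ℕ) (M : Fin (d + 1) → ℕ) [∀ μ, NeZero (M μ)] (lev : ℕ → ℕ)
    (cf : ℕ → (Fin (d + 1) → Site (d + 1) → Fin (d + 1) → Site (d + 1) → ℝ)) (w : ℕ → ℝ) (cW : ℝ)
    {V : Type*} [AddCommGroup V] [Module ℝ V]
    (hb : (k : ℕ) → V → (↥(pbox (towerTorus Lc M k)) × Fin (d + 1) → ℝ))
    (hbl : ∀ (k : ℕ) (r : ℝ) (x y : V), hb k (r • x + y) = r • hb k x + hb k y)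
    (H₁f : V → Matrix (↥(pbox (towerTorus Lc M n)) × Fin (d + 1)) (↥(pbox (towerTorus Lc M n)) × Fin (d + 1)) ℝ)
    (hH₁f : ∀ v, H₁f v = (((-2 * cW) • ∑ b : ↥(pbox (towerTorus Lc M n)) × Fin (d + 1), hb n v b •
          (perF (towerTorus Lc M n) (dper (towerTorus Lc M n) (wilsonA d b.2 (b.1 : Site (d + 1))))).submatrix
            (fun b : ↥(pbox (towerTorus Lc M n)) × Fin (d + 1) => ((b.1, Sum.inl b.2) : Idx (towerTorus Lc M n) (Fib d))) (fun b : ↥(pbox (towerTorus Lc M n)) × Fin (d + 1) => ((b.1, Sum.inl b.2) : Idx (towerTorus Lc M n) (Fib d))))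
        + w n • ∑ ā : ↥(pbox (towerTorus Lc M n)) × Fin (d + 1), hb n v ā •
            (perF (towerTorus Lc M n) (dper (towerTorus Lc M n) (SLam N (cf n) (fun μ y => symHessFFAt (toSite (ctrOff (d + 1) Lc)) Lc μ y) ā.2 (ā.1 : Site (d + 1))))).submatrix
              (fun b : ↥(pbox (towerTorus Lc M n)) × Fin (d + 1) => ((b.1, Sum.inl b.2) : Idx (towerTorus Lc M n) (Fib d))) (fun b : ↥(pbox (towerTorus Lc M n)) × Fin (d + 1) => ((b.1, Sum.inl b.2) : Idx (towerTorus Lc M n) (Fib d)))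
        + compSumSym Lc (onTowerFamily Lc M (fun k => w k • ∑ ā : ↥(pbox (towerTorus Lc M k)) × Fin (d + 1), hb k v ā •
            (perF (towerTorus Lc M k) (dper (towerTorus Lc M k) (SLam N (cf k) (fun μ y => symHessFFAt (toSite (ctrOff (d + 1) Lc)) Lc μ y) ā.2 (ā.1 : Site (d + 1))))).submatrix
              (fun b : ↥(pbox (towerTorus Lc M k)) × Fin (d + 1) => ((b.1, Sum.inl b.2) : Idx (towerTorus Lc M k) (Fib d))) (fun b : ↥(pbox (towerTorus Lc M k)) × Fin (d + 1) => ((b.1, Sum.inl b.2) : Idx (towerTorus Lc M k) (Fib d))))) M lev (fun _ => ctrOff (d + 1) Lc) n))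
    (r : ℝ) (x y : V) : H₁f (r • x + y) = r • H₁f x + H₁f y := by
  have hO : onTowerFamily Lc M (fun k => w k • ∑ ā : ↥(pbox (towerTorus Lc M k)) × Fin (d + 1), hb k (r • x + y) ā •
            (perF (towerTorus Lc M k) (dper (towerTorus Lc M k) (SLam N (cf k) (fun μ y => symHessFFAt (toSite (ctrOff (d + 1) Lc)) Lc μ y) ā.2 (ā.1 : Site (d + 1))))).submatrix
              (fun b : ↥(pbox (towerTorus Lc M k)) × Fin (d + 1) => ((b.1, Sum.inl b.2) : Idx (towerTorus Lc M k) (Fib d))) (fun b : ↥(pbox (towerTorus Lc M k)) × Fin (d + 1) => ((b.1, Sum.inl b.2) : Idx (towerTorus Lc M k) (Fib d))))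
      = r • onTowerFamily Lc M (fun k => w k • ∑ ā : ↥(pbox (towerTorus Lc M k)) × Fin (d + 1), hb k x ā •
            (perF (towerTorus Lc M k) (dper (towerTorus Lc M k) (SLam N (cf k) (fun μ y => symHessFFAt (toSite (ctrOff (d + 1) Lc)) Lc μ y) ā.2 (ā.1 : Site (d + 1))))).submatrix
              (fun b : ↥(pbox (towerTorus Lc M k)) × Fin (d + 1) => ((b.1, Sum.inl b.2) : Idx (towerTorus Lc M k) (Fib d))) (fun b : ↥(pbox (towerTorus Lc M k)) × Fin (d + 1) => ((b.1, Sum.inl b.2) : Idx (towerTorus Lc M k) (Fib d))))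
        + onTowerFamily Lc M (fun k => w k • ∑ ā : ↥(pbox (towerTorus Lc M k)) × Fin (d + 1), hb k y ā •
            (perF (towerTorus Lc M k) (dper (towerTorus Lc M k) (SLam N (cf k) (fun μ y => symHessFFAt (toSite (ctrOff (d + 1) Lc)) Lc μ y) ā.2 (ā.1 : Site (d + 1))))).submatrix
              (fun b : ↥(pbox (towerTorus Lc M k)) × Fin (d + 1) => ((b.1, Sum.inl b.2) : Idx (towerTorus Lc M k) (Fib d))) (fun b : ↥(pbox (towerTorus Lc M k)) × Fin (d + 1) => ((b.1, Sum.inl b.2) : Idx (towerTorus Lc M k) (Fib d)))) := by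
    funext T
    rw [Pi.add_apply, Pi.smul_apply, ← onTowerFamily_smul, ← onTowerFamily_add]
    congr 1
    funext k
    rw [Pi.add_apply, Pi.smul_apply, hbl k]
    exact smul_sum_smul_linear _ _ _ _ _
  rw [hH₁f, hH₁f, hH₁f, hbl n, hO]
  have hC := compSumG_add Lc (QSym Lc) (r • onTowerFamily Lc M (fun k => w k • ∑ ā : ↥(pbox (towerTorus Lc M k)) × Fin (d + 1), hb k x ā •
            (perF (towerTorus Lc M k) (dper (towerTorus Lc M k) (SLam N (cf k) (fun μ y => symHessFFAt (toSite (ctrOff (d + 1) Lc)) Lc μ y) ā.2 (ā.1 : Site (d + 1))))).submatrix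
              (fun b : ↥(pbox (towerTorus Lc M k)) × Fin (d + 1) => ((b.1, Sum.inl b.2) : Idx (towerTorus Lc M k) (Fib d))) (fun b : ↥(pbox (towerTorus Lc M k)) × Fin (d + 1) => ((b.1, Sum.inl b.2) : Idx (towerTorus Lc M k) (Fib d)))))
    (onTowerFamily Lc M (fun k => w k • ∑ ā : ↥(pbox (towerTorus Lc M k)) × Fin (d + 1), hb k y ā •
            (perF (towerTorus Lc M k) (dper (towerTorus Lc M k) (SLam N (cf k) (fun μ y => symHessFFAt (toSite (ctrOff (d + 1) Lc)) Lc μ y) ā.2 (ā.1 : Site (d + 1))))).submatrix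
              (fun b : ↥(pbox (towerTorus Lc M k)) × Fin (d + 1) => ((b.1, Sum.inl b.2) : Idx (towerTorus Lc M k) (Fib d))) (fun b : ↥(pbox (towerTorus Lc M k)) × Fin (d + 1) => ((b.1, Sum.inl b.2) : Idx (towerTorus Lc M k) (Fib d))))) M lev (fun _ => ctrOff (d + 1) Lc) n
  rw [compSumG_smul] at hC
  rw [show compSumSym Lc (r • onTowerFamily Lc M (fun k => w k • ∑ ā : ↥(pbox (towerTorus Lc M k)) × Fin (d + 1), hb k x ā •
            (perF (towerTorus Lc M k) (dper (towerTorus Lc M k) (SLam N (cf k) (fun μ y => symHessFFAt (toSite (ctrOff (d + 1) Lc)) Lc μ y) ā.2 (ā.1 : Site (d + 1))))).submatrix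
              (fun b : ↥(pbox (towerTorus Lc M k)) × Fin (d + 1) => ((b.1, Sum.inl b.2) : Idx (towerTorus Lc M k) (Fib d))) (fun b : ↥(pbox (towerTorus Lc M k)) × Fin (d + 1) => ((b.1, Sum.inl b.2) : Idx (towerTorus Lc M k) (Fib d))))
        + onTowerFamily Lc M (fun k => w k • ∑ ā : ↥(pbox (towerTorus Lc M k)) × Fin (d + 1), hb k y ā •
            (perF (towerTorus Lc M k) (dper (towerTorus Lc M k) (SLam N (cf k) (fun μ y => symHessFFAt (toSite (ctrOff (d + 1) Lc)) Lc μ y) ā.2 (ā.1 : Site (d + 1))))).submatrix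
              (fun b : ↥(pbox (towerTorus Lc M k)) × Fin (d + 1) => ((b.1, Sum.inl b.2) : Idx (towerTorus Lc M k) (Fib d))) (fun b : ↥(pbox (towerTorus Lc M k)) × Fin (d + 1) => ((b.1, Sum.inl b.2) : Idx (towerTorus Lc M k) (Fib d))))) M lev (fun _ => ctrOff (d + 1) Lc) n = _ from hC,
    smul_sum_smul_linear, smul_sum_smul_linear, smul_add, smul_add]
  abel

/-! ## §2 `hH₁t`: the prescribed `H₁f v` is antisymmetric, for every direction -/

/-- [folklore] **`H1f_transpose` — the door's `hH₁t` at the total slot, for every direction `v`**: leaf-05's `tower_H1_total_transpose` at the named companion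
family of the storeys' Λ-families (`onTowerFamily_lam_transpose`). -/
theorem H1f_transpose [NeZero Lc] [NeZero N] (n : ℕ) (M : Fin (d + 1) → ℕ) [∀ μ, NeZero (M μ)] (lev : ℕ → ℕ)
    (cf : ℕ → (Fin (d + 1) → Site (d + 1) → Fin (d + 1) → Site (d + 1) → ℝ)) (w : ℕ → ℝ) (cW : ℝ)
    {V : Type*} (hb : (k : ℕ) → V → (↥(pbox (towerTorus Lc M k)) × Fin (d + 1) → ℝ))
    (H₁f : V → Matrix (↥(pbox (towerTorus Lc M n)) × Fin (d + 1)) (↥(pbox (towerTorus Lc M n)) × Fin (d + 1)) ℝ)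
    (hH₁f : ∀ v, H₁f v = (((-2 * cW) • ∑ b : ↥(pbox (towerTorus Lc M n)) × Fin (d + 1), hb n v b •
          (perF (towerTorus Lc M n) (dper (towerTorus Lc M n) (wilsonA d b.2 (b.1 : Site (d + 1))))).submatrix
            (fun b : ↥(pbox (towerTorus Lc M n)) × Fin (d + 1) => ((b.1, Sum.inl b.2) : Idx (towerTorus Lc M n) (Fib d))) (fun b : ↥(pbox (towerTorus Lc M n)) × Fin (d + 1) => ((b.1, Sum.inl b.2) : Idx (towerTorus Lc M n) (Fib d))))
        + w n • ∑ ā : ↥(pbox (towerTorus Lc M n)) × Fin (d + 1), hb n v ā •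
            (perF (towerTorus Lc M n) (dper (towerTorus Lc M n) (SLam N (cf n) (fun μ y => symHessFFAt (toSite (ctrOff (d + 1) Lc)) Lc μ y) ā.2 (ā.1 : Site (d + 1))))).submatrix
              (fun b : ↥(pbox (towerTorus Lc M n)) × Fin (d + 1) => ((b.1, Sum.inl b.2) : Idx (towerTorus Lc M n) (Fib d))) (fun b : ↥(pbox (towerTorus Lc M n)) × Fin (d + 1) => ((b.1, Sum.inl b.2) : Idx (towerTorus Lc M n) (Fib d)))
        + compSumSym Lc (onTowerFamily Lc M (fun k => w k • ∑ ā : ↥(pbox (towerTorus Lc M k)) × Fin (d + 1), hb k v ā •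
            (perF (towerTorus Lc M k) (dper (towerTorus Lc M k) (SLam N (cf k) (fun μ y => symHessFFAt (toSite (ctrOff (d + 1) Lc)) Lc μ y) ā.2 (ā.1 : Site (d + 1))))).submatrix
              (fun b : ↥(pbox (towerTorus Lc M k)) × Fin (d + 1) => ((b.1, Sum.inl b.2) : Idx (towerTorus Lc M k) (Fib d))) (fun b : ↥(pbox (towerTorus Lc M k)) × Fin (d + 1) => ((b.1, Sum.inl b.2) : Idx (towerTorus Lc M k) (Fib d))))) M lev (fun _ => ctrOff (d + 1) Lc) n))
    (v : V) : (H₁f v)ᵀ = -H₁f v := by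
  rw [hH₁f]
  exact tower_H1_total_transpose Lc N _ (onTowerFamily_lam_transpose Lc N M cf w (fun k => hb k v)) n M lev (fun _ => ctrOff (d + 1) Lc)
    (cf n) (w n) cW (hb n v)

/-! ## §3 `a1`: the first-order Ward row at `Y₁f := 0`, for every direction, from (K1) and the links -/

/-- [folklore] **the law's finest form at level 0 IS leaf-05's level-0 form on the field block** (any root `ρ`): `(perF T (bhKStepSh d Lc (Dsh Lc) 0))|ff =
(perF T (bhKStepAt d ρ Lc 0))|ff` — entrywise `bhKStepSh_Dsh_inl_inl_eq_bhKStepAt` under the periodisation sum. -/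
theorem perF_bhKStepSh_zero_ff_eq [NeZero Lc] (n : ℕ) (M : Fin (d + 1) → ℕ) [∀ μ, NeZero (M μ)] (ρ : Fin (d + 1) → ℤ) (j : ℕ) (hj : j = 0) :
    (perF (towerTorus Lc M n) (bhKStepSh d Lc (Dsh Lc) j)).submatrix
          (fun b : ↥(pbox (towerTorus Lc M n)) × Fin (d + 1) => ((b.1, Sum.inl b.2) : Idx (towerTorus Lc M n) (Fib d))) (fun b : ↥(pbox (towerTorus Lc M n)) × Fin (d + 1) => ((b.1, Sum.inl b.2) : Idx (towerTorus Lc M n) (Fib d)))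
      = (perF (towerTorus Lc M n) (bhKStepAt d ρ Lc 0)).submatrix
          (fun b : ↥(pbox (towerTorus Lc M n)) × Fin (d + 1) => ((b.1, Sum.inl b.2) : Idx (towerTorus Lc M n) (Fib d))) (fun b : ↥(pbox (towerTorus Lc M n)) × Fin (d + 1) => ((b.1, Sum.inl b.2) : Idx (towerTorus Lc M n) (Fib d))) := by
  subst hj
  ext p q
  simp only [Matrix.submatrix_apply, perF_apply, perZ_apply]
  exact tsum_congr fun m => bhKStepSh_Dsh_inl_inl_eq_bhKStepAt Lc ρ 0 _ _ _ _

/-- [folklore] **`a1_row_eq_zero` — the door's `a1` row with the companions written, `= 0`, for every direction `v`.**  leaf-05's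
`tower_a1_row_towerGen_eq_zero_onTowerFamily` (every binder VERBATIM: top `M`, depth `n`, levels `lev`, storey data `Ma hMa cf hcf w κ hκ hκn`, bottom root `ρ`,
Wilson constant `cW`, (K1) and the links — now `∀ v` along the storey directions `hb k v`), the law's objects `H₀ W₀ W₁f` read through their pins (`H₀` in the
law's spelling at level `j = 0`, `L := Lc`). -/
theorem a1_row_eq_zero [NeZero Lc] [NeZero N] (hLc : 2 ≤ Lc) (hc : ctrOff (d + 1) Lc ∈ box (d + 1) Lc) (n : ℕ)
    (M : Fin (d + 1) → ℕ) [∀ μ, NeZero (M μ)]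
    (lev : ℕ → ℕ) (Ma : ℕ → (Fin (d + 1) → ℕ)) (hMa : ∀ k i, towerTorus Lc M k i = Lc * Ma k i)
    (cf : ℕ → (Fin (d + 1) → Site (d + 1) → Fin (d + 1) → Site (d + 1) → ℝ))
    (hcf : ∀ k κ' u μ y, Summable fun m : Site (d + 1) => cf k μ (translate (Ma k) y m) κ' u)
    (w κ : ℕ → ℝ) (hκ : ∀ k, k < n → κ k = stepScale d Lc (lev (k + 1)) * ((box (d + 1) Lc).card : ℝ) * κ (k + 1)) (hκn : κ n = 1)
    {V : Type*} (hb : (k : ℕ) → V → (↥(pbox (towerTorus Lc M k)) × Fin (d + 1) → ℝ))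
    (ρ : Fin (d + 1) → ℤ) (cW : ℝ)
    (K1 : ∀ v : V, ∀ u : ↥(pbox (towerTorus Lc M n)) × Fin (d + 1),
      cW * ((perF (towerTorus Lc M n) (bhKStepAt d ρ Lc 0)).submatrix
          (fun b : ↥(pbox (towerTorus Lc M n)) × Fin (d + 1) => ((b.1, Sum.inl b.2) : Idx (towerTorus Lc M n) (Fib d))) (fun b : ↥(pbox (towerTorus Lc M n)) × Fin (d + 1) => ((b.1, Sum.inl b.2) : Idx (towerTorus Lc M n) (Fib d)))).mulVec (hb n v) u
        = w n * ∑ ā : ↥(pbox (towerTorus Lc M n)) × Fin (d + 1), hb n v ā *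
            ∑ μ : Fin (d + 1), ∑' y : Site (d + 1), (∑' m : Site (d + 1), cf n μ (translate (Ma n) y m) ā.2 (ā.1 : Site (d + 1)))
              * symLinKerAt (toSite (ctrOff (d + 1) Lc)) Lc μ y (u.2, (u.1 : Site (d + 1))))
    (hlink : ∀ v : V, ∀ k, k < n → ∀ a : ↥(pbox (towerTorus Lc M k)) × Fin (d + 1),
      w k * κ k * (∑ ā : ↥(pbox (towerTorus Lc M k)) × Fin (d + 1), hb k v ā *
            ∑ μ : Fin (d + 1), ∑' y : Site (d + 1), (∑' m : Site (d + 1), cf k μ (translate (Ma k) y m) ā.2 (ā.1 : Site (d + 1)))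
              * symLinKerAt (toSite (ctrOff (d + 1) Lc)) Lc μ y (a.2, (a.1 : Site (d + 1))))
        = w (k + 1) * κ (k + 1) / (stepScale d Lc (lev (k + 1)) * (Lc : ℝ) ^ (d + 1)) *
          ∑ ā : ↥(pbox (towerTorus Lc M (k + 1))) × Fin (d + 1), hb (k + 1) v ā *
            ∑' m : Site (d + 1), cf (k + 1) a.2 (translate (towerTorus Lc M k) (a.1 : Site (d + 1)) m) ā.2 (ā.1 : Site (d + 1)))
    {H₀ : Matrix (↥(pbox (towerTorus Lc M n)) × Fin (d + 1)) (↥(pbox (towerTorus Lc M n)) × Fin (d + 1)) ℝ} (j : ℕ) (hj : j = 0)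
    (hH₀ : H₀ = (perF (towerTorus Lc M n) (bhKStepSh d Lc (Dsh Lc) j)).submatrix
          (fun b : ↥(pbox (towerTorus Lc M n)) × Fin (d + 1) => ((b.1, Sum.inl b.2) : Idx (towerTorus Lc M n) (Fib d))) (fun b : ↥(pbox (towerTorus Lc M n)) × Fin (d + 1) => ((b.1, Sum.inl b.2) : Idx (towerTorus Lc M n) (Fib d))))
    {W₀ : Matrix (↥(pbox (towerTorus Lc M n)) × Fin (d + 1)) (NParam Lc M (fun _ => ctrOff (d + 1) Lc) n) ℝ}
    (hW₀ : W₀ = towerGen Lc M (fun _ => ctrOff (d + 1) Lc) n)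
    (W₁f : V → Matrix (↥(pbox (towerTorus Lc M n)) × Fin (d + 1)) (NParam Lc M (fun _ => ctrOff (d + 1) Lc) n) ℝ)
    (hW₁f : ∀ v, W₁f v = Matrix.of (fun (b : ↥(pbox (towerTorus Lc M n)) × Fin (d + 1)) (e : NParam Lc M (fun _ => ctrOff (d + 1) Lc) n) =>
            -(cW * hb n v b * evalN Lc M (fun _ => ctrOff (d + 1) Lc) n
              (fun b' : ↥(pbox (towerTorus Lc M n)) × Fin (d + 1) => (b'.1 : Site (d + 1)) + unitVec b'.2) b e)))
    (H₁f : V → Matrix (↥(pbox (towerTorus Lc M n)) × Fin (d + 1)) (↥(pbox (towerTorus Lc M n)) × Fin (d + 1)) ℝ)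
    (hH₁f : ∀ v, H₁f v = (((-2 * cW) • ∑ b : ↥(pbox (towerTorus Lc M n)) × Fin (d + 1), hb n v b •
          (perF (towerTorus Lc M n) (dper (towerTorus Lc M n) (wilsonA d b.2 (b.1 : Site (d + 1))))).submatrix
            (fun b : ↥(pbox (towerTorus Lc M n)) × Fin (d + 1) => ((b.1, Sum.inl b.2) : Idx (towerTorus Lc M n) (Fib d))) (fun b : ↥(pbox (towerTorus Lc M n)) × Fin (d + 1) => ((b.1, Sum.inl b.2) : Idx (towerTorus Lc M n) (Fib d))))
        + w n • ∑ ā : ↥(pbox (towerTorus Lc M n)) × Fin (d + 1), hb n v ā •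
            (perF (towerTorus Lc M n) (dper (towerTorus Lc M n) (SLam N (cf n) (fun μ y => symHessFFAt (toSite (ctrOff (d + 1) Lc)) Lc μ y) ā.2 (ā.1 : Site (d + 1))))).submatrix
              (fun b : ↥(pbox (towerTorus Lc M n)) × Fin (d + 1) => ((b.1, Sum.inl b.2) : Idx (towerTorus Lc M n) (Fib d))) (fun b : ↥(pbox (towerTorus Lc M n)) × Fin (d + 1) => ((b.1, Sum.inl b.2) : Idx (towerTorus Lc M n) (Fib d)))
        + compSumSym Lc (onTowerFamily Lc M (fun k => w k • ∑ ā : ↥(pbox (towerTorus Lc M k)) × Fin (d + 1), hb k v ā •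
            (perF (towerTorus Lc M k) (dper (towerTorus Lc M k) (SLam N (cf k) (fun μ y => symHessFFAt (toSite (ctrOff (d + 1) Lc)) Lc μ y) ā.2 (ā.1 : Site (d + 1))))).submatrix
              (fun b : ↥(pbox (towerTorus Lc M k)) × Fin (d + 1) => ((b.1, Sum.inl b.2) : Idx (towerTorus Lc M k) (Fib d))) (fun b : ↥(pbox (towerTorus Lc M k)) × Fin (d + 1) => ((b.1, Sum.inl b.2) : Idx (towerTorus Lc M k) (Fib d))))) M lev (fun _ => ctrOff (d + 1) Lc) n))
    (v : V) : H₁f v * W₀ + H₀ * W₁f v = 0 := by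
  rw [hH₁f, hW₀, hH₀, hW₁f, perF_bhKStepSh_zero_ff_eq Lc n M ρ j hj]
  exact tower_a1_row_towerGen_eq_zero_onTowerFamily Lc N hLc hc n M lev Ma hMa cf hcf w κ hκ hκn (fun k => hb k v) ρ Lc cW (K1 v) (hlink v)

/-- [folklore] **`a1_row` — the same row in the door's LITERAL shape `H₁f v * W₀ + H₀ * W₁f v = 𝔔₀ᵀ * Y₁f v` at `Y₁f := 0`** (any `𝔔₀`; `Matrix.mul_zero`). -/
theorem a1_row [NeZero Lc] [NeZero N] (hLc : 2 ≤ Lc) (hc : ctrOff (d + 1) Lc ∈ box (d + 1) Lc) (n : ℕ)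
    (M : Fin (d + 1) → ℕ) [∀ μ, NeZero (M μ)]
    (lev : ℕ → ℕ) (Ma : ℕ → (Fin (d + 1) → ℕ)) (hMa : ∀ k i, towerTorus Lc M k i = Lc * Ma k i)
    (cf : ℕ → (Fin (d + 1) → Site (d + 1) → Fin (d + 1) → Site (d + 1) → ℝ))
    (hcf : ∀ k κ' u μ y, Summable fun m : Site (d + 1) => cf k μ (translate (Ma k) y m) κ' u)
    (w κ : ℕ → ℝ) (hκ : ∀ k, k < n → κ k = stepScale d Lc (lev (k + 1)) * ((box (d + 1) Lc).card : ℝ) * κ (k + 1)) (hκn : κ n = 1)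
    {V : Type*} (hb : (k : ℕ) → V → (↥(pbox (towerTorus Lc M k)) × Fin (d + 1) → ℝ))
    (ρ : Fin (d + 1) → ℤ) (cW : ℝ)
    (K1 : ∀ v : V, ∀ u : ↥(pbox (towerTorus Lc M n)) × Fin (d + 1),
      cW * ((perF (towerTorus Lc M n) (bhKStepAt d ρ Lc 0)).submatrix
          (fun b : ↥(pbox (towerTorus Lc M n)) × Fin (d + 1) => ((b.1, Sum.inl b.2) : Idx (towerTorus Lc M n) (Fib d))) (fun b : ↥(pbox (towerTorus Lc M n)) × Fin (d + 1) => ((b.1, Sum.inl b.2) : Idx (towerTorus Lc M n) (Fib d)))).mulVec (hb n v) u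
        = w n * ∑ ā : ↥(pbox (towerTorus Lc M n)) × Fin (d + 1), hb n v ā *
            ∑ μ : Fin (d + 1), ∑' y : Site (d + 1), (∑' m : Site (d + 1), cf n μ (translate (Ma n) y m) ā.2 (ā.1 : Site (d + 1)))
              * symLinKerAt (toSite (ctrOff (d + 1) Lc)) Lc μ y (u.2, (u.1 : Site (d + 1))))
    (hlink : ∀ v : V, ∀ k, k < n → ∀ a : ↥(pbox (towerTorus Lc M k)) × Fin (d + 1),
      w k * κ k * (∑ ā : ↥(pbox (towerTorus Lc M k)) × Fin (d + 1), hb k v ā *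
            ∑ μ : Fin (d + 1), ∑' y : Site (d + 1), (∑' m : Site (d + 1), cf k μ (translate (Ma k) y m) ā.2 (ā.1 : Site (d + 1)))
              * symLinKerAt (toSite (ctrOff (d + 1) Lc)) Lc μ y (a.2, (a.1 : Site (d + 1))))
        = w (k + 1) * κ (k + 1) / (stepScale d Lc (lev (k + 1)) * (Lc : ℝ) ^ (d + 1)) *
          ∑ ā : ↥(pbox (towerTorus Lc M (k + 1))) × Fin (d + 1), hb (k + 1) v ā *
            ∑' m : Site (d + 1), cf (k + 1) a.2 (translate (towerTorus Lc M k) (a.1 : Site (d + 1)) m) ā.2 (ā.1 : Site (d + 1)))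
    {H₀ : Matrix (↥(pbox (towerTorus Lc M n)) × Fin (d + 1)) (↥(pbox (towerTorus Lc M n)) × Fin (d + 1)) ℝ} (j : ℕ) (hj : j = 0)
    (hH₀ : H₀ = (perF (towerTorus Lc M n) (bhKStepSh d Lc (Dsh Lc) j)).submatrix
          (fun b : ↥(pbox (towerTorus Lc M n)) × Fin (d + 1) => ((b.1, Sum.inl b.2) : Idx (towerTorus Lc M n) (Fib d))) (fun b : ↥(pbox (towerTorus Lc M n)) × Fin (d + 1) => ((b.1, Sum.inl b.2) : Idx (towerTorus Lc M n) (Fib d))))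
    {W₀ : Matrix (↥(pbox (towerTorus Lc M n)) × Fin (d + 1)) (NParam Lc M (fun _ => ctrOff (d + 1) Lc) n) ℝ}
    (hW₀ : W₀ = towerGen Lc M (fun _ => ctrOff (d + 1) Lc) n)
    (W₁f : V → Matrix (↥(pbox (towerTorus Lc M n)) × Fin (d + 1)) (NParam Lc M (fun _ => ctrOff (d + 1) Lc) n) ℝ)
    (hW₁f : ∀ v, W₁f v = Matrix.of (fun (b : ↥(pbox (towerTorus Lc M n)) × Fin (d + 1)) (e : NParam Lc M (fun _ => ctrOff (d + 1) Lc) n) =>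
            -(cW * hb n v b * evalN Lc M (fun _ => ctrOff (d + 1) Lc) n
              (fun b' : ↥(pbox (towerTorus Lc M n)) × Fin (d + 1) => (b'.1 : Site (d + 1)) + unitVec b'.2) b e)))
    (H₁f : V → Matrix (↥(pbox (towerTorus Lc M n)) × Fin (d + 1)) (↥(pbox (towerTorus Lc M n)) × Fin (d + 1)) ℝ)
    (hH₁f : ∀ v, H₁f v = (((-2 * cW) • ∑ b : ↥(pbox (towerTorus Lc M n)) × Fin (d + 1), hb n v b •
          (perF (towerTorus Lc M n) (dper (towerTorus Lc M n) (wilsonA d b.2 (b.1 : Site (d + 1))))).submatrix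
            (fun b : ↥(pbox (towerTorus Lc M n)) × Fin (d + 1) => ((b.1, Sum.inl b.2) : Idx (towerTorus Lc M n) (Fib d))) (fun b : ↥(pbox (towerTorus Lc M n)) × Fin (d + 1) => ((b.1, Sum.inl b.2) : Idx (towerTorus Lc M n) (Fib d))))
        + w n • ∑ ā : ↥(pbox (towerTorus Lc M n)) × Fin (d + 1), hb n v ā •
            (perF (towerTorus Lc M n) (dper (towerTorus Lc M n) (SLam N (cf n) (fun μ y => symHessFFAt (toSite (ctrOff (d + 1) Lc)) Lc μ y) ā.2 (ā.1 : Site (d + 1))))).submatrix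
              (fun b : ↥(pbox (towerTorus Lc M n)) × Fin (d + 1) => ((b.1, Sum.inl b.2) : Idx (towerTorus Lc M n) (Fib d))) (fun b : ↥(pbox (towerTorus Lc M n)) × Fin (d + 1) => ((b.1, Sum.inl b.2) : Idx (towerTorus Lc M n) (Fib d)))
        + compSumSym Lc (onTowerFamily Lc M (fun k => w k • ∑ ā : ↥(pbox (towerTorus Lc M k)) × Fin (d + 1), hb k v ā •
            (perF (towerTorus Lc M k) (dper (towerTorus Lc M k) (SLam N (cf k) (fun μ y => symHessFFAt (toSite (ctrOff (d + 1) Lc)) Lc μ y) ā.2 (ā.1 : Site (d + 1))))).submatrix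
              (fun b : ↥(pbox (towerTorus Lc M k)) × Fin (d + 1) => ((b.1, Sum.inl b.2) : Idx (towerTorus Lc M k) (Fib d))) (fun b : ↥(pbox (towerTorus Lc M k)) × Fin (d + 1) => ((b.1, Sum.inl b.2) : Idx (towerTorus Lc M k) (Fib d))))) M lev (fun _ => ctrOff (d + 1) Lc) n))
    {ι : Type*} [Fintype ι] (𝔔₀ : Matrix ι (↥(pbox (towerTorus Lc M n)) × Fin (d + 1)) ℝ)
    (v : V) : H₁f v * W₀ + H₀ * W₁f v = 𝔔₀ᵀ * (0 : Matrix ι (NParam Lc M (fun _ => ctrOff (d + 1) Lc) n) ℝ) := by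
  rw [Matrix.mul_zero]
  exact a1_row_eq_zero Lc N hLc hc n M lev Ma hMa cf hcf w κ hκ hκn hb ρ cW K1 hlink j hj hH₀ hW₀ W₁f hW₁f H₁f hH₁f v

end Summit.QuantumFields.BalabanUV.Beta.FP.TowerHSideRowsClosing

end
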